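import Summits.Schanuel.Schanuel.Theorems.SoloInformedX193TwistFamily

/-!
# X193 kernel line, file F4: no cheap depth at activating columns (NCD, pen §3)

Solo seat `solo-Schanuel-informed`, X193 kernel programme (design note
`work/s213/X193-KERNEL-DESIGN.md`, Amendment A10; pen proof `work/s194/X193-pen.md` §3;
files F2 = `SoloInformedX193Service`, F4a = `SoloInformedX193TwistFamily`,
F6a = `SoloInformedX193Exceptional`).

File F6a recorded the no-cheap-depth statement as the hypothesis family
`SoloServiceData.noCheapDepth σ ν β A₃ n₃`: at every large level `n`, an active bank of an
alive piece, truncated at the requirement `n^ν`, is at most the running cost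
`C_P(n) = g_P n^β + L_P n` plus `A₃ n² log (n+2)`.  This file PROVES it for an abstract
service structure `D : SoloServiceData ι` from the laws (WF), (Bud), (L1) = `entryLaw`,
(TW) = `twistLaw` and (FIN) = `finiteLaw`, with `A₃ = 2 + 9 A₂`, for exponents `1 ≤ β`,
`2 < ν`, `1 + β < σ + ν`, `0 < σ ≤ 1` (`noCheapDepth_of_laws`; in X193 one has
`σ + ν = 1 + β + γ` with `γ > 0`).  The near-root hypothesis of `noCheapDepth` is not
needed: (L1) is stated for arbitrary active columns and (TW) transports every bank.

The argument (pen §3, re-cut as a descent on levels; toolkit in file F4a).  Suppose the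
bank `d_P^k` of `P` (alive at `n`) at an active column `k`, truncated at `n^ν`, exceeds
`C_P(n) + A₃ n² log (n+2)`.  The twists `Q_j = twist P k j` carry that bank to every
column `j` (`d_{Q_j}^j ≥ d_P^k - g log (max k j)`) at the same degree and almost the same
height.  Call a level `ℓ` BAD if some twist `Q_j` with `j` active at `ℓ` is not alive at `ℓ`.
* Level `n` is not bad: an absent active twist is exposed to (L1) at `ℓ = n` with the
  single column `j` (`exposure`), which bounds `min (d_{Q_j}^j, n^ν)` by
  `C_{Q_j}(n) + A₂ (n + g + 1)² log (n+2)`, hence `min (d_P^k, n^ν)` by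
  `C_P(n) + (2 + 9 A₂) n² log (n+2)` (`twist_min_le`).
* If a threshold level `m₁ ≤ n` were bad, take the largest bad level `ℓ < n` in
  `[m₁, n]`; its witness `Q = Q_j` is absent at `ℓ`, so (L1) applies at `ℓ`.  If
  `d_Q^j < ℓ^ν` the same computation contradicts the assumption.  Otherwise
  `ℓ^ν ≤ C_Q(ℓ+1) + 4 A₂ (ℓ+1)² log (ℓ+3)`, and at the GOOD level `m = ℓ + 1` all
  `⌊m^σ⌋₊` active twists are alive, pairwise distinct, each of cost at least
  `C_Q(m) - m² log (m+2)` (`family_budget`); the cost budget `2 m^β m + b₁ m²` of level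
  `m` then contradicts `σ + ν > 1 + β` once `m ≥ L₀` (`soloX_family_eventually`), and
  `m > m₁ ≥ L₀`.
* So `m₁` is good: `Q_1` is alive at `m₁`, its bank at column `1` is bounded by (FIN),
  and transporting back bounds `d_P^k` by `D₁ + g log k ≤ C_P(n) + n² log (n+2)`.
No sorries.
-/

namespace Summit.Schanuel.Schanuel.Theorems

open Finset Filter

namespace SoloServiceData

variable {ι : Type*} (D : SoloServiceData ι)

/-! ### NCD from the laws -/

/-- **No cheap depth, from the laws** (pen §3 NCD↑; DESIGN A10): under (WF), (Bud), (L1),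
(TW) and (FIN), for `1 ≤ β`, `2 < ν`, `1 + β < σ + ν`, `0 < σ ≤ 1`, `b₁, A₂ ≥ 0`, there
is a level `n₃` from which every active bank of an alive piece satisfies
`min (d_P^k, n^ν) ≤ C_P(n) + (2 + 9 A₂) n² log (n+2)`; in particular
`D ∈ noCheapDepth σ ν β (2 + 9 A₂) n₃` (the hypothesis consumed by files F6a/F6c). -/
theorem noCheapDepth_of_laws {c₀ β b₁ σ ν A₂ : ℝ} {n₀ : ℕ} (hW : D ∈ wellFormed c₀)
    (hB : D ∈ budgetLaw β b₁ n₀) (hE : D ∈ entryLaw β σ ν A₂ n₀) (hT : D ∈ twistLaw)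
    (hF : D ∈ finiteLaw) (hβ : 1 ≤ β) (hν : 2 < ν) (hgap : 1 + β < σ + ν) (hσ : 0 < σ)
    (hσ1 : σ ≤ 1) (hb₁ : 0 ≤ b₁) (hA₂ : 0 ≤ A₂) :
    ∃ n₃ : ℕ, D ∈ noCheapDepth σ ν β (2 + 9 * A₂) n₃ := by
  classical
  obtain ⟨L₀, hL₀⟩ := Filter.eventually_atTop.mp
    (soloX_family_eventually hσ hν hgap hβ hb₁ hA₂)
  obtain ⟨m₁, hm₁def⟩ : ∃ m₁ : ℕ, m₁ = max L₀ (max n₀ 1) := ⟨_, rfl⟩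
  have hL₀m₁ : L₀ ≤ m₁ := hm₁def ▸ le_max_left _ _
  have hn₀m₁ : n₀ ≤ m₁ := hm₁def ▸ (le_max_left _ _).trans (le_max_right _ _)
  have h1m₁ : 1 ≤ m₁ := hm₁def ▸ (le_max_right _ _).trans (le_max_right _ _)
  obtain ⟨D₁, hD₁⟩ := hF m₁
  refine ⟨max m₁ ⌈D₁⌉₊, fun n hn P hP k hk hkσ _ => ?_⟩
  obtain ⟨hm₁n, hDn⟩ : m₁ ≤ n ∧ ⌈D₁⌉₊ ≤ n := by simpa only [max_le_iff] using hn
  have hn₀ : n₀ ≤ n := hn₀m₁.trans hm₁n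
  have hn1 : 1 ≤ n := h1m₁.trans hm₁n
  have hn1' : (1 : ℝ) ≤ n := by exact_mod_cast hn1
  have hn0 : (0 : ℝ) ≤ n := by positivity
  have hlog : 0 ≤ Real.log ((n : ℝ) + 2) := Real.log_nonneg (by linarith)
  by_contra hcon
  push Not at hcon
  -- (a) level `n` is good
  have hgoodn : ∀ j : ℕ, 1 ≤ j → (j : ℝ) ≤ (n : ℝ) ^ σ → D.twist P k j ∈ D.alive n := by
    intro j hj hjσ
    by_contra hQ
    have h := D.twist_min_le hW hB hT hσ1 hA₂ hn₀ hn1 hP hk hkσ hj hjσ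
      (D.exposure hE hn₀ hQ hj hjσ)
    linarith
  -- (b) the threshold level `m₁` is good
  have hgoodm : ∀ j : ℕ, 1 ≤ j → (j : ℝ) ≤ (m₁ : ℝ) ^ σ → D.twist P k j ∈ D.alive m₁ := by
    by_contra hbad
    push Not at hbad
    obtain ⟨j₁, hj₁, hj₁σ, hj₁a⟩ := hbad
    obtain ⟨Bad, hBad⟩ : ∃ Bad : Finset ℕ, Bad = (Finset.Icc m₁ n).filter (fun ℓ : ℕ =>
        ∃ j : ℕ, 1 ≤ j ∧ (j : ℝ) ≤ (ℓ : ℝ) ^ σ ∧ D.twist P k j ∉ D.alive ℓ) := ⟨_, rfl⟩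
    have hmemB : ∀ ℓ : ℕ, ℓ ∈ Bad ↔ (m₁ ≤ ℓ ∧ ℓ ≤ n) ∧
        ∃ j : ℕ, 1 ≤ j ∧ (j : ℝ) ≤ (ℓ : ℝ) ^ σ ∧ D.twist P k j ∉ D.alive ℓ := by
      intro ℓ
      rw [hBad, Finset.mem_filter, Finset.mem_Icc]
    have hm₁B : m₁ ∈ Bad := (hmemB m₁).mpr ⟨⟨le_rfl, hm₁n⟩, j₁, hj₁, hj₁σ, hj₁a⟩
    have hne : Bad.Nonempty := ⟨m₁, hm₁B⟩
    obtain ⟨⟨hm₁ℓ, hℓn⟩, j, hj, hjσ, hQ⟩ := (hmemB _).mp (Finset.max'_mem Bad hne)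
    have hmax : ∀ ℓ' ∈ Bad, ℓ' ≤ Bad.max' hne := fun ℓ' h => Finset.le_max' Bad ℓ' h
    set ℓ : ℕ := Bad.max' hne with hℓdef
    have hn₀ℓ : n₀ ≤ ℓ := hn₀m₁.trans hm₁ℓ
    have hℓR : (ℓ : ℝ) ≤ n := by exact_mod_cast hℓn
    have hℓ0 : (0 : ℝ) ≤ ℓ := by positivity
    have hjn : (j : ℝ) ≤ (n : ℝ) ^ σ :=
      hjσ.trans (Real.rpow_le_rpow hℓ0 hℓR hσ.le)
    have hℓn' : ℓ < n := by
      by_contra hge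
      have h : ℓ = n := le_antisymm hℓn (not_lt.mp hge)
      rw [h] at hQ
      exact hQ (hgoodn j hj hjn)
    -- the levels above `ℓ` are good
    have hgood : ∀ ℓ' : ℕ, ℓ < ℓ' → ℓ' ≤ n → ∀ j' : ℕ, 1 ≤ j' →
        (j' : ℝ) ≤ (ℓ' : ℝ) ^ σ → D.twist P k j' ∈ D.alive ℓ' := by
      intro ℓ' h1 h2 j' hj' hj'σ
      by_contra hQ'
      have hℓ'B : ℓ' ∈ Bad := (hmemB ℓ').mpr ⟨⟨by omega, h2⟩, j', hj', hj'σ, hQ'⟩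
      have := hmax ℓ' hℓ'B
      omega
    have hexp := D.exposure hE hn₀ℓ hQ hj hjσ
    have hdegQ : (D.deg (D.twist P k j) : ℝ) = D.deg P := by
      exact_mod_cast D.deg_twist hT P hk hj
    have hgQ0 : (0 : ℝ) ≤ D.deg (D.twist P k j) := by positivity
    rcases lt_or_ge (D.bank (D.twist P k j) j) ((ℓ : ℝ) ^ ν) with hpart | hfull
    · -- partial at the entry: exposed at `ℓ`, priced at `n`
      rw [min_eq_left hpart.le] at hexp
      have hcm : D.cost β (D.twist P k j) ℓ ≤ D.cost β (D.twist P k j) n :=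
        D.cost_mono hW (by linarith) _ hℓn
      have hsq : ((ℓ : ℝ) + D.deg (D.twist P k j) + 1) ^ 2 ≤
          ((n : ℝ) + D.deg (D.twist P k j) + 1) ^ 2 :=
        pow_le_pow_left₀ (by positivity) (by linarith) 2
      have hlg : Real.log ((ℓ : ℝ) + 2) ≤ Real.log ((n : ℝ) + 2) :=
        Real.log_le_log (by positivity) (by linarith)
      have hlg0 : 0 ≤ Real.log ((ℓ : ℝ) + 2) := Real.log_nonneg (by linarith)
      have herr := mul_le_mul (mul_le_mul_of_nonneg_left hsq hA₂) hlg hlg0 (by positivity)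
      have hQ' : min (D.bank (D.twist P k j) j) ((n : ℝ) ^ ν) ≤ D.cost β (D.twist P k j) n +
          A₂ * ((n : ℝ) + D.deg (D.twist P k j) + 1) ^ 2 * Real.log ((n : ℝ) + 2) := by
        linarith [min_le_left (D.bank (D.twist P k j) j) ((n : ℝ) ^ ν)]
      have h := D.twist_min_le hW hB hT hσ1 hA₂ hn₀ hn1 hP hk hkσ hj hjn hQ'
      linarith
    · -- full at the entry: the family at the good level `ℓ + 1`
      rw [min_eq_right hfull] at hexp
      have hgm := hgood (ℓ + 1) (by omega) (by omega)
      have hℓ1R : ((ℓ + 1 : ℕ) : ℝ) = (ℓ : ℝ) + 1 := by push_cast; ring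
      have hjσ' : (j : ℝ) ≤ ((ℓ + 1 : ℕ) : ℝ) ^ σ :=
        hjσ.trans (Real.rpow_le_rpow hℓ0 (by rw [hℓ1R]; linarith) hσ.le)
      have hfam := D.family_budget hW hB hT hσ1 (by omega : n₀ ≤ ℓ + 1) (by omega) hk hj
        hjσ' hgm
      have hg : (D.deg P : ℝ) ≤ (ℓ : ℝ) + 1 := by
        have h := D.deg_le_level hW hB (by omega : n₀ ≤ ℓ + 1) (hgm j hj hjσ')
        rw [D.deg_twist hT P hk hj, hℓ1R] at h
        exact h
      have hcm : D.cost β (D.twist P k j) ℓ ≤ D.cost β (D.twist P k j) (ℓ + 1) :=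
        D.cost_mono hW (by linarith) _ (by omega)
      have herr : A₂ * ((ℓ : ℝ) + D.deg (D.twist P k j) + 1) ^ 2 * Real.log ((ℓ : ℝ) + 2) ≤
          4 * A₂ * ((ℓ : ℝ) + 1) ^ 2 * Real.log ((ℓ : ℝ) + 1 + 2) := by
        rw [hdegQ]
        have hsq : ((ℓ : ℝ) + D.deg P + 1) ^ 2 ≤ (2 * ((ℓ : ℝ) + 1)) ^ 2 :=
          pow_le_pow_left₀ (by positivity) (by linarith) 2
        have hlg : Real.log ((ℓ : ℝ) + 2) ≤ Real.log ((ℓ : ℝ) + 1 + 2) :=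
          Real.log_le_log (by positivity) (by linarith)
        have hlg0 : 0 ≤ Real.log ((ℓ : ℝ) + 2) := Real.log_nonneg (by linarith)
        nlinarith [mul_le_mul (mul_le_mul_of_nonneg_left hsq hA₂) hlg hlg0 (by positivity)]
      have hth := hL₀ (ℓ + 1) (by omega)
      rw [hℓ1R] at hfam hth
      rw [show (ℓ : ℝ) + 1 - 1 = ℓ by ring] at hth
      have hfl0 : (0 : ℝ) ≤ (⌊((ℓ : ℝ) + 1) ^ σ⌋₊ : ℝ) := by positivity
      have hineq : (ℓ : ℝ) ^ ν - (1 + 4 * A₂) * ((ℓ : ℝ) + 1) ^ 2 * Real.log ((ℓ : ℝ) + 1 + 2) ≤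
          D.cost β (D.twist P k j) (ℓ + 1) - ((ℓ : ℝ) + 1) ^ 2 * Real.log ((ℓ : ℝ) + 1 + 2) := by
        linarith
      have hmul := mul_le_mul_of_nonneg_left hineq hfl0
      linarith
  -- (c) the bank of `Q_1` at column `1`
  have h1σ : ((1 : ℕ) : ℝ) ≤ (m₁ : ℝ) ^ σ := by
    rw [Nat.cast_one]
    exact Real.one_le_rpow (by exact_mod_cast h1m₁) hσ.le
  have hb1 : D.bank (D.twist P k 1) 1 ≤ D₁ := hD₁ _ (hgoodm 1 le_rfl h1σ) 1 le_rfl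
  have htw := D.bank_twist_ge hT P hk (le_refl 1)
  rw [max_eq_left hk] at htw
  have hD₁n : D₁ ≤ n := (Nat.le_ceil D₁).trans (by exact_mod_cast hDn)
  have hg : (D.deg P : ℝ) ≤ n := D.deg_le_level hW hB hn₀ hP
  have hkn : (k : ℝ) ≤ (n : ℝ) + 2 := hkσ.trans (by
    calc (n : ℝ) ^ σ ≤ (n : ℝ) ^ (1 : ℝ) := Real.rpow_le_rpow_of_exponent_le hn1' hσ1
      _ ≤ (n : ℝ) + 2 := by rw [Real.rpow_one]; linarith)
  have hk1 : (1 : ℝ) ≤ k := by exact_mod_cast hk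
  have hlk : Real.log (k : ℝ) ≤ Real.log ((n : ℝ) + 2) := Real.log_le_log (by linarith) hkn
  have hlk0 : 0 ≤ Real.log (k : ℝ) := Real.log_nonneg hk1
  have hglk : (D.deg P : ℝ) * Real.log (k : ℝ) ≤ (n : ℝ) ^ 2 * Real.log ((n : ℝ) + 2) := by
    rw [pow_two]
    have h1 := mul_le_mul hg hlk hlk0 hn0
    have h2 := mul_le_mul_of_nonneg_right hn1' (mul_nonneg hn0 hlog)
    linarith
  have hnc : (n : ℝ) ≤ D.cost β P n :=
    (Real.self_le_rpow_of_one_le hn1' hβ).trans (D.rpow_le_cost hW β P n)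
  have hmin : min (D.bank P k) ((n : ℝ) ^ ν) ≤ D.bank P k := min_le_left _ _
  have hpos : 0 ≤ (1 + 9 * A₂) * ((n : ℝ) ^ 2 * Real.log ((n : ℝ) + 2)) := by positivity
  linarith

end SoloServiceData

end Summit.Schanuel.Schanuel.Theorems
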